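import Mathlib
import Summits.Ventures.PercRepro2.Sep2Gamma

/-!
# THE UNIFIED o-SHIELD: `K = {x, a₁}` separating `o` from `{b, a₂}` gives `btw(x) = 0`
(blind cell PercRepro2, night-1 g33; proofs/NIGHT1-G33.md §8; census mining/night-1/g33/check_mixed_sep.py,
check_mixed_sep2.py — 152/152)

Setting: `IsSep2 ends x a₁ ↑VA ↑VB EA EB`, the mark `o ∈ VA`, the root `a₂` and the mark `b` in `VB`,
`D = P(PD_x) ≠ 0`.  Law of total covariance on the root classes of the `x`-fibres: on the fibres
`W ∋ a₁` the functional `F⁰_o` is the constant `γ` (`SFg_c1`); on the fibres `W ∋ a₂` and on the fibres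
without roots `F⁰_o` is affine in `P(fibre, a₁ ↔ o)` (`SFg_of_mem_a2`, `SFg_c3`) while `σ_b` is read on the
`B`-side, so by the conditional independence of Sep2Gamma the products `σ_b F⁰_o / m_W` are sums of fibre
probabilities (`term_c2`, `term_c3`, `termA_c3`), and by the `γ`-identity every class sum of
`σ_b (F⁰_o − γ m_W) / m_W` vanishes: `∑_W Sb F⁰_o / m_W = γ ∑_W Sb` (`sum_term_eq`),
`∑_W F⁰_o = γ P(Q)` (`sum_SFg_eq`), `∑_A Sub Suo / m_W = γ ∑_A Sub` (`sum_termA_eq`), `∑_A Suo = γ D`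
(`sum_SuA_o_eq`).  Hence **`btw(x; o, b) = 0`** (`btw_sep2_o`), (MEANS-a₃) and (HCOV) at `x`
unconditionally (`A3Between_sep2_o`, `HCov_sep2_o`; `D = 0` by `RootEdge.A3Between_of_PD_null`).  With
the landed `K = {x}` (`CutOBehind.btw_cut_oBehind`) and `K = {a₁, a₂}` (`RootShield.btw_rootShield_o`)
classes this completes the o-SHIELD PRINCIPLE of §8.  Standard axioms.
-/

namespace Summit.Ventures.PercRepro2

open UnionCluster CovForm CutV Sep2

namespace CovForm

namespace A3Fibre

namespace Sep2Shield

section Classes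

variable {V : Type*} {E : Type*} [Fintype V] [DecidableEq V] [Fintype E] [DecidableEq E]
  {R : Type*} [Field R] [LinearOrder R] [IsStrictOrderedRing R] {ends : E → Sym2 V} {x a₁ : V}
  {VA VB : Finset V} {EA EB : Set E} [DecidablePred (· ∈ EA)] [DecidablePred (· ∈ EB)] {p : E → R}
  {o a₂ b : V}

omit [Fintype V] [DecidableEq V] [Fintype E] [DecidableEq E] [Field R] [LinearOrder R]
  [IsStrictOrderedRing R] [DecidablePred (· ∈ EA)] [DecidablePred (· ∈ EB)] in
/-- Replacing two events on a fibre. -/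
lemma inter_inter_congr {f A A' B B' : Set (Config E)} (hA : f ∩ A = f ∩ A')
    (hB : f ∩ B = f ∩ B') : f ∩ (A ∩ B) = f ∩ (A' ∩ B') := by
  ext ω
  have h1 := Set.ext_iff.1 hA ω
  have h2 := Set.ext_iff.1 hB ω
  simp only [Set.mem_inter_iff] at h1 h2 ⊢
  tauto

/-! ## The class events -/

omit [Fintype V] [DecidableEq V] [Fintype E] [DecidableEq E] [Field R] [LinearOrder R]
  [IsStrictOrderedRing R] in
/-- `Q ∩ Z ∩ {x ↮ a₁, x ↔ a₂}` is the product `N × (B₂ ∩ Z)` for a `Z` read on the `B`-side when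
`x ↮ a₁`. -/
lemma Q_inter_G2_eq (h : IsSep2 ends x a₁ ↑VA ↑VB EA EB) (h2 : a₂ ∈ VB) {Z : Set (Config E)}
    (hZ : ∀ ω : Config E, ¬ Conn ends ω x a₁ → (ω ∈ Z ↔ restrict EB ω ∈ Z)) :
    avoidAll ends a₂ {a₁} ∩ Z ∩ ((connEvent ends x a₁)ᶜ ∩ connEvent ends x a₂) =
      sideEvent EA (connEvent ends x a₁)ᶜ ∩
        sideEvent EB ((connEvent ends x a₁)ᶜ ∩ connEvent ends x a₂ ∩ avoidAll ends a₂ {a₁} ∩ Z) := by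
  ext ω
  simp only [Set.mem_inter_iff, mem_sideEvent, mem_connEvent, Set.mem_compl_iff, mem_avoidAll,
    Finset.mem_singleton, forall_eq]
  constructor
  · rintro ⟨⟨hQ, hZω⟩, hx1, hc⟩
    exact ⟨fun hc' => hx1 (conn_mono (restrict_le EA ω) hc'),
      ⟨⟨fun hc' => hx1 (conn_mono (restrict_le EB ω) hc'),
        (conn_iff_restrict_of_not_conn h.symm hx1 (Or.inr (Or.inl rfl))
          (Or.inl (Finset.mem_coe.2 h2))).1 hc⟩,
        fun hc' => hQ (conn_mono (restrict_le EB ω) hc')⟩, (hZ ω hx1).1 hZω⟩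
  · rintro ⟨hA, ⟨⟨hB, hc⟩, hQ⟩, hZω⟩
    have hx1 : ¬ Conn ends ω x a₁ := fun hc' => by
      rcases (conn_x_a1_iff h).1 hc' with hc' | hc'
      · exact hA hc'
      · exact hB hc'
    refine ⟨⟨?_, (hZ ω hx1).2 hZω⟩, hx1, conn_mono (restrict_le EB ω) hc⟩
    intro hc'
    exact hQ ((conn_iff_restrict_of_not_conn h.symm hx1 (Or.inl (Finset.mem_coe.2 h2))
      (Or.inr (Or.inr rfl))).1 hc')

omit [Fintype V] [DecidableEq V] [Fintype E] [DecidableEq E] [Field R] [LinearOrder R]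
  [IsStrictOrderedRing R] in
/-- `Q ∩ Z ∩ {x ↮ a₁, x ↮ a₂}` is the product `N × (B₃ ∩ Z)`. -/
lemma Q_inter_G3_eq (h : IsSep2 ends x a₁ ↑VA ↑VB EA EB) (h2 : a₂ ∈ VB) {Z : Set (Config E)}
    (hZ : ∀ ω : Config E, ¬ Conn ends ω x a₁ → (ω ∈ Z ↔ restrict EB ω ∈ Z)) :
    avoidAll ends a₂ {a₁} ∩ Z ∩ ((connEvent ends x a₁)ᶜ ∩ (connEvent ends x a₂)ᶜ) =
      sideEvent EA (connEvent ends x a₁)ᶜ ∩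
        sideEvent EB ((connEvent ends x a₁)ᶜ ∩ (connEvent ends x a₂)ᶜ ∩ avoidAll ends a₂ {a₁} ∩ Z) := by
  ext ω
  simp only [Set.mem_inter_iff, mem_sideEvent, mem_connEvent, Set.mem_compl_iff, mem_avoidAll,
    Finset.mem_singleton, forall_eq]
  constructor
  · rintro ⟨⟨hQ, hZω⟩, hx1, hc⟩
    exact ⟨fun hc' => hx1 (conn_mono (restrict_le EA ω) hc'),
      ⟨⟨fun hc' => hx1 (conn_mono (restrict_le EB ω) hc'),
        fun hc' => hc (conn_mono (restrict_le EB ω) hc')⟩,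
        fun hc' => hQ (conn_mono (restrict_le EB ω) hc')⟩, (hZ ω hx1).1 hZω⟩
  · rintro ⟨hA, ⟨⟨hB, hc⟩, hQ⟩, hZω⟩
    have hx1 : ¬ Conn ends ω x a₁ := fun hc' => by
      rcases (conn_x_a1_iff h).1 hc' with hc' | hc'
      · exact hA hc'
      · exact hB hc'
    refine ⟨⟨?_, (hZ ω hx1).2 hZω⟩, hx1, ?_⟩
    · intro hc'
      exact hQ ((conn_iff_restrict_of_not_conn h.symm hx1 (Or.inl (Finset.mem_coe.2 h2))
        (Or.inr (Or.inr rfl))).1 hc')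
    · intro hc'
      exact hc ((conn_iff_restrict_of_not_conn h.symm hx1 (Or.inr (Or.inl rfl))
        (Or.inl (Finset.mem_coe.2 h2))).1 hc')

omit [Fintype V] [DecidableEq V] [LinearOrder R] [IsStrictOrderedRing R] in
/-- **The `γ`-identity on the class `{x ↔ a₂}`**. -/
lemma prob_G2_conn_o (h : IsSep2 ends x a₁ ↑VA ↑VB EA EB) (ho : o ∈ VA) (h2 : a₂ ∈ VB)
    (hD : prob p (PDEvent ends a₁ a₂ x) ≠ 0) {Z : Set (Config E)}
    (hZ : ∀ ω : Config E, ¬ Conn ends ω x a₁ → (ω ∈ Z ↔ restrict EB ω ∈ Z)) :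
    prob p (avoidAll ends a₂ {a₁} ∩ (connEvent ends a₁ o ∩ Z) ∩
        ((connEvent ends x a₁)ᶜ ∩ connEvent ends x a₂)) =
      gamma p ends o a₁ a₂ x *
        prob p (avoidAll ends a₂ {a₁} ∩ Z ∩ ((connEvent ends x a₁)ᶜ ∩ connEvent ends x a₂)) := by
  have e : avoidAll ends a₂ {a₁} ∩ (connEvent ends a₁ o ∩ Z) ∩
      ((connEvent ends x a₁)ᶜ ∩ connEvent ends x a₂) =
      avoidAll ends a₂ {a₁} ∩ Z ∩ ((connEvent ends x a₁)ᶜ ∩ connEvent ends x a₂) ∩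
        connEvent ends a₁ o := by
    ext ω; simp only [Set.mem_inter_iff]; tauto
  rw [e, Q_inter_G2_eq h h2 hZ, prob_class_conn_o h ho h2 hD (fun ω hω => hω.1.1.1)]

omit [Fintype V] [DecidableEq V] [LinearOrder R] [IsStrictOrderedRing R] in
/-- **The `γ`-identity on the class `PD`**. -/
lemma prob_G3_conn_o (h : IsSep2 ends x a₁ ↑VA ↑VB EA EB) (ho : o ∈ VA) (h2 : a₂ ∈ VB)
    (hD : prob p (PDEvent ends a₁ a₂ x) ≠ 0) {Z : Set (Config E)}
    (hZ : ∀ ω : Config E, ¬ Conn ends ω x a₁ → (ω ∈ Z ↔ restrict EB ω ∈ Z)) :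
    prob p (avoidAll ends a₂ {a₁} ∩ (connEvent ends a₁ o ∩ Z) ∩
        ((connEvent ends x a₁)ᶜ ∩ (connEvent ends x a₂)ᶜ)) =
      gamma p ends o a₁ a₂ x *
        prob p (avoidAll ends a₂ {a₁} ∩ Z ∩ ((connEvent ends x a₁)ᶜ ∩ (connEvent ends x a₂)ᶜ)) := by
  have e : avoidAll ends a₂ {a₁} ∩ (connEvent ends a₁ o ∩ Z) ∩
      ((connEvent ends x a₁)ᶜ ∩ (connEvent ends x a₂)ᶜ) =
      avoidAll ends a₂ {a₁} ∩ Z ∩ ((connEvent ends x a₁)ᶜ ∩ (connEvent ends x a₂)ᶜ) ∩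
        connEvent ends a₁ o := by
    ext ω; simp only [Set.mem_inter_iff]; tauto
  rw [e, Q_inter_G3_eq h h2 hZ, prob_class_conn_o h ho h2 hD (fun ω hω => hω.1.1.1)]

omit [Fintype V] [DecidableEq V] [Fintype E] [DecidableEq E] [Field R] [LinearOrder R]
  [IsStrictOrderedRing R] in
/-- A connection event between vertices of `VB ∪ {x, a₁}` is read on the `B`-side when `x ↮ a₁`. -/
lemma bside_conn (h : IsSep2 ends x a₁ ↑VA ↑VB EA EB) {u v : V} (hu : u ∈ (↑VB : Set V) ∪ {x, a₁})
    (hv : v ∈ (↑VB : Set V) ∪ {x, a₁}) (ω : Config E) (hx1 : ¬ Conn ends ω x a₁) :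
    ω ∈ connEvent ends u v ↔ restrict EB ω ∈ connEvent ends u v :=
  conn_iff_restrict_of_not_conn h.symm hx1 hu hv

omit [Fintype V] [DecidableEq V] [Fintype E] [DecidableEq E] [Field R] [LinearOrder R]
  [IsStrictOrderedRing R] [DecidablePred (· ∈ EA)] in
/-- The full space is read on the `B`-side. -/
lemma bside_univ (ω : Config E) (_ : ¬ Conn ends ω x a₁) :
    ω ∈ (Set.univ : Set (Config E)) ↔ restrict EB ω ∈ (Set.univ : Set (Config E)) := by
  simp

/-! ## The fibre terms of the three root classes -/

omit [Fintype V] [LinearOrder R] [IsStrictOrderedRing R] [DecidablePred (· ∈ EB)] in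
/-- On a fibre `W ∋ a₁`, `F⁰_o(γ) = γ m_W`. -/
lemma SFg_c1 (h : IsSep2 ends x a₁ ↑VA ↑VB EA EB) (ho : o ∈ VA) (h2 : a₂ ∈ VB) {W : Finset V}
    (ha1 : a₁ ∈ W) (γ : R) : RootEdge.SFg p ends o a₁ a₂ x γ W = γ * mW p ends a₁ a₂ x W := by
  rw [MarkPull.SFg_of_mem_a1 o γ ha1, fibre_inter_conn_a2_o_of_mem_a1 h ho h2 ha1, prob_empty]
  ring

omit [Fintype V] [LinearOrder R] [IsStrictOrderedRing R] [DecidablePred (· ∈ EB)] in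
/-- On a fibre without roots, `F⁰_o(γ) = P(fibre, a₁ ↔ o)`. -/
lemma SFg_c3 (h : IsSep2 ends x a₁ ↑VA ↑VB EA EB) (ho : o ∈ VA) (h2 : a₂ ∈ VB) {W : Finset V}
    (ha1 : a₁ ∉ W) (ha2 : a₂ ∉ W) (γ : R) :
    RootEdge.SFg p ends o a₁ a₂ x γ W = prob p (fibre ends a₁ a₂ x W ∩ connEvent ends a₁ o) := by
  unfold RootEdge.SFg Ssig s3
  rw [if_neg ha1, if_neg ha2, fibre_inter_conn_a2_o_of_notMem h ho h2 ha2, prob_empty]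
  ring

omit [Fintype V] [LinearOrder R] [IsStrictOrderedRing R] in
/-- On a fibre `W ∌ a₁`, `P(fibre, a₁ ↔ b) P(fibre, a₁ ↔ o) = m_W P(fibre, a₁ ↔ o, a₁ ↔ b)`
(conditional independence), for `b ∈ VB`. -/
lemma prob_cab_mul_cao (h : IsSep2 ends x a₁ ↑VA ↑VB EA EB) (ho : o ∈ VA) (h2 : a₂ ∈ VB)
    {u : V} (hu : u ∈ (↑VB : Set V) ∪ {x, a₁}) (hb : b ∈ VB) {W : Finset V} (ha1 : a₁ ∉ W) :
    prob p (fibre ends a₁ a₂ x W ∩ connEvent ends u b) *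
        prob p (fibre ends a₁ a₂ x W ∩ connEvent ends a₁ o) =
      mW p ends a₁ a₂ x W *
        prob p (fibre ends a₁ a₂ x W ∩ (connEvent ends a₁ o ∩ connEvent ends u b)) := by
  have key := prob_fibre_inter_mul (p := p) h h2 ha1 (connEvent ends a₁ o) (connEvent ends u b)
  rw [← fibre_inter_conn_a1_o h ho ha1,
    ← fibre_inter_conn_B h hu (Or.inl (Finset.mem_coe.2 hb)) ha1,
    ← inter_inter_congr (fibre_inter_conn_a1_o h ho ha1)
      (fibre_inter_conn_B h hu (Or.inl (Finset.mem_coe.2 hb)) ha1)] at key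
  rw [mul_comm, key]
  rfl

omit [Fintype V] [LinearOrder R] [IsStrictOrderedRing R] [DecidablePred (· ∈ EA)]
  [DecidablePred (· ∈ EB)] in
/-- `P(fibre, a₁ ↔ o, x ↔ b) = [b ∈ W] P(fibre, a₁ ↔ o)`. -/
lemma prob_cao_cxb (o b : V) {W : Finset V} :
    prob p (fibre ends a₁ a₂ x W ∩ (connEvent ends a₁ o ∩ connEvent ends x b)) =
      (if b ∈ W then 1 else 0) * prob p (fibre ends a₁ a₂ x W ∩ connEvent ends a₁ o) := by
  have e : fibre ends a₁ a₂ x W ∩ (connEvent ends a₁ o ∩ connEvent ends x b) =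
      fibre ends a₁ a₂ x W ∩ connEvent ends x b ∩ connEvent ends a₁ o := by
    ext ω; simp only [Set.mem_inter_iff]; tauto
  rw [e, fibre_inter_conn_x b]
  by_cases hb : b ∈ W
  · rw [if_pos hb, if_pos hb, one_mul]
  · rw [if_neg hb, if_neg hb, zero_mul, Set.empty_inter, prob_empty]

omit [Fintype V] [LinearOrder R] [IsStrictOrderedRing R] [DecidablePred (· ∈ EA)]
  [DecidablePred (· ∈ EB)] in
/-- `P(fibre, x ↔ b) = [b ∈ W] m_W`. -/
lemma prob_cxb (b : V) {W : Finset V} :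
    prob p (fibre ends a₁ a₂ x W ∩ connEvent ends x b) =
      (if b ∈ W then 1 else 0) * mW p ends a₁ a₂ x W := by
  rw [fibre_inter_conn_x b]
  by_cases hb : b ∈ W
  · rw [if_pos hb, if_pos hb, one_mul]
    rfl
  · rw [if_neg hb, if_neg hb, zero_mul, prob_empty]

omit [Fintype V] [LinearOrder R] [IsStrictOrderedRing R] [DecidablePred (· ∈ EA)]
  [DecidablePred (· ∈ EB)] in
/-- On a fibre `W ∋ a₂`, `Sb = P(fibre, a₁ ↔ b) − [b ∈ W] m_W`. -/
lemma Ssig_b_c2 (b : V) {W : Finset V} (ha2 : a₂ ∈ W) :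
    Ssig p ends a₁ a₂ x b W =
      prob p (fibre ends a₁ a₂ x W ∩ connEvent ends a₁ b) -
        (if b ∈ W then 1 else 0) * mW p ends a₁ a₂ x W := by
  unfold Ssig
  rw [fibre_inter_conn_of_mem_left ha2 b]
  by_cases hb : b ∈ W
  · rw [if_pos hb, if_pos hb, one_mul]
    rfl
  · rw [if_neg hb, if_neg hb, zero_mul, prob_empty]

omit [Fintype V] in
/-- **The `σ_b F⁰_o`-term on a fibre `W ∋ a₂`**: `Sb F⁰_o / m_W − γ Sb` is a sum of fibre
probabilities. -/
lemma term_c2 (hp : IsProbVec p) (h : IsSep2 ends x a₁ ↑VA ↑VB EA EB) (ho : o ∈ VA)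
    (h2 : a₂ ∈ VB) (hb : b ∈ VB) {W : Finset V} (ha1 : a₁ ∉ W) (ha2 : a₂ ∈ W) (γ : R) :
    Ssig p ends a₁ a₂ x b W * RootEdge.SFg p ends o a₁ a₂ x γ W / mW p ends a₁ a₂ x W -
        γ * Ssig p ends a₁ a₂ x b W =
      2 * (prob p (fibre ends a₁ a₂ x W ∩ (connEvent ends a₁ o ∩ connEvent ends a₁ b)) -
        γ * prob p (fibre ends a₁ a₂ x W ∩ connEvent ends a₁ b) -
        prob p (fibre ends a₁ a₂ x W ∩ (connEvent ends a₁ o ∩ connEvent ends x b)) +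
        γ * prob p (fibre ends a₁ a₂ x W ∩ connEvent ends x b)) := by
  have e1 := prob_cab_mul_cao (p := p) h ho h2 (Or.inr (Or.inr rfl)) hb ha1
  rw [prob_cao_cxb, prob_cxb, Ssig_b_c2 b ha2, MarkPull.SFg_of_mem_a2 o γ ha2]
  by_cases hm : mW p ends a₁ a₂ x W = 0
  · have hf : prob p (fibre ends a₁ a₂ x W) = 0 := hm
    rw [hm, div_zero, prob_fibre_inter_eq_zero hp ends a₁ a₂ x hf,
      prob_fibre_inter_eq_zero hp ends a₁ a₂ x hf, prob_fibre_inter_eq_zero hp ends a₁ a₂ x hf]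
    ring
  · rw [div_sub' hm, div_eq_iff hm]
    linear_combination 2 * e1

omit [Fintype V] [DecidableEq V] [LinearOrder R] [IsStrictOrderedRing R] [DecidablePred (· ∈ EA)]
  [DecidablePred (· ∈ EB)] in
/-- `Sb = P(fibre, a₁ ↔ b) − P(fibre, a₂ ↔ b)` and `Ub = P(fibre, a₁ ↔ b) + P(fibre, a₂ ↔ b)`. -/
lemma Ssig_Su_eq (v : V) (W : Finset V) :
    Ssig p ends a₁ a₂ x v W = prob p (fibre ends a₁ a₂ x W ∩ connEvent ends a₁ v) -
        prob p (fibre ends a₁ a₂ x W ∩ connEvent ends a₂ v) ∧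
      Su p ends a₁ a₂ x v W = prob p (fibre ends a₁ a₂ x W ∩ connEvent ends a₁ v) +
        prob p (fibre ends a₁ a₂ x W ∩ connEvent ends a₂ v) := ⟨rfl, rfl⟩

omit [Fintype V] in
/-- **The `σ_b F⁰_o`-term on a fibre without roots.** -/
lemma term_c3 (hp : IsProbVec p) (h : IsSep2 ends x a₁ ↑VA ↑VB EA EB) (ho : o ∈ VA)
    (h2 : a₂ ∈ VB) (hb : b ∈ VB) {W : Finset V} (ha1 : a₁ ∉ W) (ha2 : a₂ ∉ W) (γ : R) :
    Ssig p ends a₁ a₂ x b W * RootEdge.SFg p ends o a₁ a₂ x γ W / mW p ends a₁ a₂ x W -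
        γ * Ssig p ends a₁ a₂ x b W =
      prob p (fibre ends a₁ a₂ x W ∩ (connEvent ends a₁ o ∩ connEvent ends a₁ b)) -
        prob p (fibre ends a₁ a₂ x W ∩ (connEvent ends a₁ o ∩ connEvent ends a₂ b)) -
        γ * prob p (fibre ends a₁ a₂ x W ∩ connEvent ends a₁ b) +
        γ * prob p (fibre ends a₁ a₂ x W ∩ connEvent ends a₂ b) := by
  have e1 := prob_cab_mul_cao (p := p) h ho h2 (Or.inr (Or.inr rfl)) hb ha1
  have e2 := prob_cab_mul_cao (p := p) h ho h2 (Or.inl (Finset.mem_coe.2 h2)) hb ha1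
  rw [SFg_c3 h ho h2 ha1 ha2, (Ssig_Su_eq b W).1]
  by_cases hm : mW p ends a₁ a₂ x W = 0
  · have hf : prob p (fibre ends a₁ a₂ x W) = 0 := hm
    rw [hm, div_zero]
    simp only [prob_fibre_inter_eq_zero hp ends a₁ a₂ x hf]
    ring
  · rw [div_sub' hm, div_eq_iff hm]
    linear_combination e1 - e2

omit [Fintype V] in
/-- **The `U_b U_o`-term on a fibre without roots.** -/
lemma termA_c3 (hp : IsProbVec p) (h : IsSep2 ends x a₁ ↑VA ↑VB EA EB) (ho : o ∈ VA)
    (h2 : a₂ ∈ VB) (hb : b ∈ VB) {W : Finset V} (ha1 : a₁ ∉ W) (ha2 : a₂ ∉ W) :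
    Su p ends a₁ a₂ x b W * Su p ends a₁ a₂ x o W / mW p ends a₁ a₂ x W =
      prob p (fibre ends a₁ a₂ x W ∩ (connEvent ends a₁ o ∩ connEvent ends a₁ b)) +
        prob p (fibre ends a₁ a₂ x W ∩ (connEvent ends a₁ o ∩ connEvent ends a₂ b)) := by
  have e1 := prob_cab_mul_cao (p := p) h ho h2 (Or.inr (Or.inr rfl)) hb ha1
  have e2 := prob_cab_mul_cao (p := p) h ho h2 (Or.inl (Finset.mem_coe.2 h2)) hb ha1
  rw [(Ssig_Su_eq b W).2, (Ssig_Su_eq o W).2, fibre_inter_conn_a2_o_of_notMem h ho h2 ha2,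
    prob_empty, add_zero]
  by_cases hm : mW p ends a₁ a₂ x W = 0
  · have hf : prob p (fibre ends a₁ a₂ x W) = 0 := hm
    rw [hm, div_zero]
    simp only [prob_fibre_inter_eq_zero hp ends a₁ a₂ x hf]
    ring
  · rw [div_eq_iff hm]
    linear_combination e1 + e2

end Classes

end Sep2Shield

end A3Fibre

end CovForm

end Summit.Ventures.PercRepro2
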